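import Literature.NumberTheory.Sieve.ChenTwin
import HarnessLib

/-!
# Chen's Theorem II for a general even shift `h`: the sieve set-up with Chen's parameters

Topic `Literature/NumberTheory/Sieve`. `Literature.NumberTheory.Sieve.ChenTwin` vendors Chen's
Theorem II as printed (Chen Jing-run, Sci. Sinica 16 (1973), Thm II: for every even `h ≠ 0`,
`x_h(1,2) ≥ 0.67 x C_h/(log x)²` for large `x`; `Literature.NumberTheory.Sieve.Chen.Chen1973_theoremII`)
and sets up the sieve decomposition of the twin case `h = 2` with NATHANSON's parameters
`z = x^{1/8}`, `y = x^{1/3}` (which yield the qualitative `chen_twin` but only the constant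
`4(2 log 3 − log 6 − c) ≈ 0.17`). The printed constant `0.67` requires CHEN's parameters
(§III and Lemma 9 of the paper, PDF pp. 167–168 of the reprint in Wang Yuan (ed.), *Goldbach
Conjecture*, 1984): sieving level `x^{1/10}` (so that the linear sieve enters through `f₁(5)`) and
`y = x^{1/3}`, for the sequence `𝒜_h(x) = {p + h : p ≤ x}` with an arbitrary fixed even shift `h`.
This file provides that set-up, mirroring the `h = 2` set-up of `ChenTwin`:

* `shiftSieveSet h x = {p + h : p prime, p ≤ x}`, `chenZ x = ⌈x^{1/10}⌉`,
  `chenY h x = ⌈(x + h + 1)^{1/3}⌉` (every element is `< (chenY h x)³`), and the switched set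
  `chenSetBShift h x = {p₁p₂p₃ − h : ⌈x^{1/10}⌉ ≤ p₁ < y ≤ p₂ ≤ p₃, p₁p₂p₃ ≤ x + h}`
  (Chen's `Ω` counts the primes of this set);
* PROVED: `tripleCount_shift_le` (`T(𝒜_h(x); z, y) ≤ y + S(B_h(x), y)`, the passage to the switched
  set), `almostPrimeTwoCount_shift_le` (the `P₂`-elements of `𝒜_h(x)` are counted by Chen's
  `x_h(1,2) = shiftedPrimeAlmostPrimeCount h x`), membership and size lemmas, and the bound
  `chen_shift_errorTerms_le` for the discarded terms `y/2 + (x + h)/(z − 1) ≤ 6 x^{9/10}`.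

The assembly of Theorem II from the three sieve estimates with Chen's constants is in the companion
file `ChenShiftedAssembly`. No named facts are introduced.

## References

* Chen Jing-run, Sci. Sinica 16 (1973) 157–176, §I (Theorem II, `x_h(1,2)`), §III (34) and
  Lemmas 8–9 (reprint: Wang Yuan (ed.), *Goldbach Conjecture*, World Scientific 1984, PDF pp. 150,
  166–168). [ChenSciSinica1973]
* M. B. Nathanson, *Additive Number Theory: The Classical Bases*, GTM 164 (1996), §10.2 (the sets
  `A`, `B` and Thm 10.2). [Nathanson1996]
-/

open Finset Filter Topology
open scoped ArithmeticFunction.Omega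

noncomputable section

namespace Literature.NumberTheory.Sieve.Chen

open ChenSieve

/-! ### The set-up -/

/-- `𝒜_h(x) = {p + h : p prime, p ≤ x}`, the finite set sifted in Chen's Theorem II (Chen 1973, §I:
`x_h(1,2)` counts the `p ≤ x` with `p + h = p₁` or `p₂p₃`). [cite: ChenSciSinica1973, §I and Theorem II (reprint p. 150)] -/
def shiftSieveSet (h x : ℕ) : Finset ℕ :=
  ((Finset.range (x + 1)).filter Nat.Prime).map (addRightEmbedding h)

/-- Chen's sieving level `z(x) = ⌈x^{1/10}⌉` (Chen 1973, Lemma 9 and (34): `P_x(x, x^{1/10})`).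
[cite: ChenSciSinica1973, Lemma 9 (reprint p. 167)] -/
def chenZ (x : ℕ) : ℕ :=
  ⌈(x : ℝ) ^ (1 / 10 : ℝ)⌉₊

/-- `y_h(x) = ⌈(x + h + 1)^{1/3}⌉` (Chen's `x^{1/3}`; the shift makes every element `p + h ≤ x + h`
of `𝒜_h(x)` strictly less than `y³`). [cite: ChenSciSinica1973, §III eq. (34) (reprint p. 168)] -/
def chenY (h x : ℕ) : ℕ :=
  ⌈((x : ℝ) + h + 1) ^ (1 / 3 : ℝ)⌉₊

/-- The switched set `B_h(x) = {p₁p₂p₃ − h : z ≤ p₁ < y ≤ p₂ ≤ p₃ primes, p₁p₂p₃ ≤ x + h}`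
(`z = chenZ x`, `y = chenY h x`); Chen's `Ω` is the number of primes in it (Lemma 8).
[cite: ChenSciSinica1973, Lemma 8 (reprint p. 166)] -/
def chenSetBShift (h x : ℕ) : Finset ℕ :=
  ((Finset.range (x + h + 1) ×ˢ Finset.range (x + h + 1) ×ˢ Finset.range (x + h + 1)).filter
      (fun t : ℕ × ℕ × ℕ => t.1.Prime ∧ t.2.1.Prime ∧ t.2.2.Prime ∧ chenZ x ≤ t.1 ∧
        t.1 < chenY h x ∧ chenY h x ≤ t.2.1 ∧ t.2.1 ≤ t.2.2 ∧ t.1 * t.2.1 * t.2.2 ≤ x + h)).image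
    fun t => t.1 * t.2.1 * t.2.2 - h

/-! ### Elementary properties -/

/-- Membership in `𝒜_h(x)`. [folklore] -/
theorem mem_shiftSieveSet {h x n : ℕ} :
    n ∈ shiftSieveSet h x ↔ ∃ p : ℕ, p.Prime ∧ p ≤ x ∧ p + h = n := by
  simp only [shiftSieveSet, Finset.mem_map, Finset.mem_filter, Finset.mem_range,
    addRightEmbedding_apply]
  constructor
  · rintro ⟨p, ⟨hx, hp⟩, rfl⟩
    exact ⟨p, hp, by omega, rfl⟩
  · rintro ⟨p, hp, hx, rfl⟩
    exact ⟨p, ⟨by omega, hp⟩, rfl⟩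

/-- `𝒜_h(x) ⊆ (0, x + h]`. [folklore] -/
theorem shiftSieveSet_subset_Ioc (h x : ℕ) : shiftSieveSet h x ⊆ Finset.Ioc 0 (x + h) := by
  intro n hn
  obtain ⟨p, hp, hx, rfl⟩ := mem_shiftSieveSet.mp hn
  have := hp.two_le
  simp only [Finset.mem_Ioc]
  omega

/-- `#𝒜_h(x) = π(x)`. [folklore] -/
theorem card_shiftSieveSet (h x : ℕ) : #(shiftSieveSet h x) = Nat.primeCounting x := by
  rw [shiftSieveSet, Finset.card_map, Nat.primeCounting, Nat.primeCounting', Nat.count_eq_card_filter_range]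

/-- `x + h < y_h(x)³`. [folklore] -/
theorem lt_chenY_pow (h x : ℕ) : x + h < chenY h x ^ 3 := by
  have h0 : (0 : ℝ) ≤ (x : ℝ) + h + 1 := by positivity
  have h1 : (((x : ℝ) + h + 1) ^ (1 / 3 : ℝ)) ^ (3 : ℕ) = (x : ℝ) + h + 1 := by
    rw [show (1 / 3 : ℝ) = ((3 : ℕ) : ℝ)⁻¹ by norm_num, Real.rpow_inv_natCast_pow h0 three_ne_zero]
  have h2 : (x : ℝ) + h + 1 ≤ ((chenY h x : ℕ) : ℝ) ^ 3 := by
    rw [← h1, chenY]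
    exact pow_le_pow_left₀ (Real.rpow_nonneg h0 _) (Nat.le_ceil _) 3
  have h3 : ((x + h : ℕ) : ℝ) < ((chenY h x ^ 3 : ℕ) : ℝ) := by
    push_cast
    linarith
  exact_mod_cast h3

/-- `z(x) ≥ 2` for `x ≥ 2`. [folklore] -/
theorem two_le_chenZ {x : ℕ} (hx : 2 ≤ x) : 2 ≤ chenZ x := by
  have h1 : (1 : ℝ) < (x : ℝ) ^ (1 / 10 : ℝ) :=
    Real.one_lt_rpow (by exact_mod_cast hx) (by norm_num)
  have h2 : 1 < chenZ x := Nat.lt_ceil.mpr (by exact_mod_cast h1)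
  omega

/-- `x^{1/10} ≤ z(x)`. [folklore] -/
theorem rpow_le_chenZ (x : ℕ) : (x : ℝ) ^ (1 / 10 : ℝ) ≤ chenZ x := Nat.le_ceil _

/-- `z(x) ≤ q ↔ x^{1/10} ≤ q` for integers `q`. [folklore] -/
theorem chenZ_le_iff {x q : ℕ} : chenZ x ≤ q ↔ (x : ℝ) ^ (1 / 10 : ℝ) ≤ q := Nat.ceil_le

/-- `q < y_h(x) ↔ q < (x + h + 1)^{1/3}` for integers `q`. [folklore] -/
theorem lt_chenY_iff {h x q : ℕ} : q < chenY h x ↔ (q : ℝ) < ((x : ℝ) + h + 1) ^ (1 / 3 : ℝ) :=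
  Nat.lt_ceil

/-- Membership in `B_h(x)`. [folklore] -/
theorem mem_chenSetBShift {h x m : ℕ} :
    m ∈ chenSetBShift h x ↔ ∃ p₁ p₂ p₃ : ℕ, p₁.Prime ∧ p₂.Prime ∧ p₃.Prime ∧ chenZ x ≤ p₁ ∧
      p₁ < chenY h x ∧ chenY h x ≤ p₂ ∧ p₂ ≤ p₃ ∧ p₁ * p₂ * p₃ ≤ x + h ∧ m = p₁ * p₂ * p₃ - h := by
  simp only [chenSetBShift, Finset.mem_image, Finset.mem_filter, Finset.mem_product,
    Finset.mem_range, Prod.exists]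
  constructor
  · rintro ⟨a, b, c, ⟨-, ha, hb, hc, h1, h2, h3, h4, h5⟩, rfl⟩
    exact ⟨a, b, c, ha, hb, hc, h1, h2, h3, h4, h5, rfl⟩
  · rintro ⟨a, b, c, ha, hb, hc, h1, h2, h3, h4, h5, rfl⟩
    have ha1 := ha.one_lt.le
    have hb1 := hb.one_lt.le
    have hc1 := hc.one_lt.le
    refine ⟨a, b, c, ⟨⟨?_, ?_, ?_⟩, ha, hb, hc, h1, h2, h3, h4, h5⟩, rfl⟩
    · have : a ≤ a * b * c := by
        calc a = a * 1 * 1 := by ring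
          _ ≤ a * b * c := by gcongr
      omega
    · have : b ≤ a * b * c := by
        calc b = 1 * b * 1 := by ring
          _ ≤ a * b * c := by gcongr
      omega
    · have : c ≤ a * b * c := by
        calc c = 1 * 1 * c := by ring
          _ ≤ a * b * c := by gcongr
      omega

/-! ### The third weight and Chen's `x_h(1,2)` -/

/-- **`T(𝒜_h(x); z, y) ≤ y + S(B_h(x), y)`**: an element `p + h = p₁p₂p₃` of `𝒜_h(x)` counted by `T`
gives the prime `p = p₁p₂p₃ − h` of `B_h(x)`; those `≥ y` are `y`-rough, the others are fewer than
`y` (Chen's passage from the third weight of (34) to `Ω`; Nathanson p. 273 for `h = 2`).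
[cite: ChenSciSinica1973, §III eq. (34) and Lemma 8 (reprint pp. 166–168)] -/
theorem tripleCount_shift_le (h x : ℕ) :
    tripleCount (shiftSieveSet h x) (chenZ x) (chenY h x) ≤
      chenY h x + roughCount (chenSetBShift h x) (chenY h x) := by
  classical
  set z := chenZ x
  set y := chenY h x
  have hinj : Set.InjOn (fun n : ℕ => n - h)
      ((shiftSieveSet h x).filter fun n => IsChenTriple z y n) := by
    intro a ha b hb hab
    have ha2 : h ≤ a := by
      obtain ⟨p, -, -, rfl⟩ := mem_shiftSieveSet.mp (Finset.mem_filter.mp ha).1; omega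
    have hb2 : h ≤ b := by
      obtain ⟨p, -, -, rfl⟩ := mem_shiftSieveSet.mp (Finset.mem_filter.mp hb).1; omega
    simp only at hab
    omega
  have himage : ((shiftSieveSet h x).filter fun n => IsChenTriple z y n).image (fun n : ℕ => n - h) ⊆
      (chenSetBShift h x).filter Nat.Prime := by
    intro m hm
    rw [Finset.mem_image] at hm
    obtain ⟨n, hn, rfl⟩ := hm
    rw [Finset.mem_filter] at hn ⊢
    obtain ⟨p, hp, hpx, rfl⟩ := mem_shiftSieveSet.mp hn.1
    obtain ⟨p₁, p₂, p₃, h₁, h₂, h₃, hz, hy, hy', h23, heq⟩ := hn.2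
    refine ⟨mem_chenSetBShift.mpr ⟨p₁, p₂, p₃, h₁, h₂, h₃, hz, hy, hy', h23, by omega, by omega⟩, ?_⟩
    simpa using hp
  calc tripleCount (shiftSieveSet h x) z y
      = #(((shiftSieveSet h x).filter fun n => IsChenTriple z y n).image fun n : ℕ => n - h) := by
        rw [tripleCount, Finset.card_image_of_injOn hinj]
    _ ≤ #((chenSetBShift h x).filter Nat.Prime) := Finset.card_le_card himage
    _ ≤ #((chenSetBShift h x).filter fun m => m.Prime ∧ m < y) +
          #((chenSetBShift h x).filter fun m => m.Prime ∧ y ≤ m) := by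
        rw [← Finset.card_union_of_disjoint]
        · refine Finset.card_le_card fun m hm => ?_
          rw [Finset.mem_filter] at hm
          rw [Finset.mem_union, Finset.mem_filter, Finset.mem_filter]
          by_cases hlt : m < y
          · exact Or.inl ⟨hm.1, hm.2, hlt⟩
          · exact Or.inr ⟨hm.1, hm.2, not_lt.mp hlt⟩
        · rw [Finset.disjoint_filter]
          intro m _ h1 h2
          omega
    _ ≤ y + roughCount (chenSetBShift h x) y := by
        gcongr
        · calc #((chenSetBShift h x).filter fun m => m.Prime ∧ m < y)
              ≤ #(Finset.range y) := by
                refine Finset.card_le_card fun m hm => ?_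
                rw [Finset.mem_filter] at hm
                exact Finset.mem_range.mpr hm.2.2
            _ = y := Finset.card_range y
        · rw [roughCount]
          refine Finset.card_le_card fun m hm => ?_
          rw [Finset.mem_filter] at hm ⊢
          refine ⟨hm.1, fun p hp => ?_⟩
          rw [Nat.mem_primeFactors] at hp
          have : p = m := (Nat.prime_dvd_prime_iff_eq hp.1 hm.2.1).mp hp.2.1
          omega

/-- The `P₂`-count of `𝒜_h(x)` is at most Chen's `x_h(1,2)` (`shiftedPrimeAlmostPrimeCount h x`): an
element `p + h ≥ 2` with `Ω(p + h) ≤ 2` has `Ω(p + h) ∈ {1, 2}`. [folklore] -/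
theorem almostPrimeTwoCount_shift_le (h x : ℕ) :
    almostPrimeTwoCount (shiftSieveSet h x) ≤ shiftedPrimeAlmostPrimeCount h x := by
  classical
  rw [almostPrimeTwoCount, shiftedPrimeAlmostPrimeCount]
  have hinj : Set.InjOn (fun n : ℕ => n - h)
      ((shiftSieveSet h x).filter fun n => Nat.IsAtMostAlmostPrime 2 n) := by
    intro a ha b hb hab
    have ha2 : h ≤ a := by
      obtain ⟨p, -, -, rfl⟩ := mem_shiftSieveSet.mp (Finset.mem_filter.mp ha).1; omega
    have hb2 : h ≤ b := by
      obtain ⟨p, -, -, rfl⟩ := mem_shiftSieveSet.mp (Finset.mem_filter.mp hb).1; omega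
    simp only at hab
    omega
  rw [← Finset.card_image_of_injOn hinj]
  refine Finset.card_le_card fun m hm => ?_
  rw [Finset.mem_image] at hm
  obtain ⟨n, hn, rfl⟩ := hm
  rw [Finset.mem_filter] at hn ⊢
  obtain ⟨p, hp, hpx, rfl⟩ := mem_shiftSieveSet.mp hn.1
  simp only [Nat.add_sub_cancel, Finset.mem_range]
  refine ⟨by omega, hp, ?_⟩
  obtain ⟨h0, hΩ⟩ := hn.2
  have hp2 := hp.two_le
  have hΩ1 : 1 ≤ Ω (p + h) := by
    rw [Nat.one_le_iff_ne_zero, Ne, ArithmeticFunction.cardFactors_eq_zero_iff_eq_zero_or_one]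
    omega
  rcases Nat.lt_or_ge (Ω (p + h)) 2 with hlt | hge
  · exact Or.inl ⟨h0, by omega⟩
  · exact Or.inr ⟨h0, by omega⟩

/-! ### The discarded terms -/

/-- The discarded terms of the weighted sieve with Chen's parameters:
`y/2 + (x + h)/(z − 1) ≤ 6 x^{9/10}` for `x ≥ 1024` and `x ≥ h + 1`. [folklore] -/
theorem chen_shift_errorTerms_le {h x : ℕ} (hx : 1024 ≤ x) (hhx : h + 1 ≤ x) :
    (chenY h x : ℝ) / 2 + ((x : ℝ) + h) / ((chenZ x : ℝ) - 1) ≤ 6 * (x : ℝ) ^ (9 / 10 : ℝ) := by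
  have hx1 : (1 : ℝ) ≤ x := by exact_mod_cast (show 1 ≤ x by omega)
  have hx0 : (0 : ℝ) < x := by linarith
  have hhx' : (h : ℝ) + 1 ≤ x := by exact_mod_cast hhx
  set P := (x : ℝ) ^ (9 / 10 : ℝ) with hP
  have hP1 : 1 ≤ P := Real.one_le_rpow hx1 (by norm_num)
  -- `y ≤ 3 P`
  have hy : (chenY h x : ℝ) ≤ 3 * P := by
    have h1 : (chenY h x : ℝ) < ((x : ℝ) + h + 1) ^ (1 / 3 : ℝ) + 1 :=
      Nat.ceil_lt_add_one (by positivity)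
    have h2 : ((x : ℝ) + h + 1) ^ (1 / 3 : ℝ) ≤ 2 * P := by
      have h3 : ((x : ℝ) + h + 1) ≤ 8 * x := by linarith
      calc ((x : ℝ) + h + 1) ^ (1 / 3 : ℝ) ≤ (8 * x) ^ (1 / 3 : ℝ) :=
            Real.rpow_le_rpow (by positivity) h3 (by norm_num)
        _ = 2 * (x : ℝ) ^ (1 / 3 : ℝ) := by
            rw [Real.mul_rpow (by norm_num) hx0.le,
              show (8 : ℝ) = (2 : ℝ) ^ (3 : ℕ) by norm_num, ← Real.rpow_natCast,
              ← Real.rpow_mul (by norm_num)]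
            norm_num
        _ ≤ 2 * P := by
            gcongr
            exact Real.rpow_le_rpow_of_exponent_le hx1 (by norm_num)
    linarith
  -- `(x + h)/(z − 1) ≤ 4 P`
  have hz : (x : ℝ) ^ (1 / 10 : ℝ) ≤ chenZ x := Nat.le_ceil _
  have h10 : (2 : ℝ) ≤ (x : ℝ) ^ (1 / 10 : ℝ) := by
    rw [show (2 : ℝ) = ((2 : ℝ) ^ (10 : ℕ)) ^ (1 / 10 : ℝ) by
      rw [← Real.rpow_natCast, ← Real.rpow_mul (by norm_num)]; norm_num]
    exact Real.rpow_le_rpow (by norm_num) (by exact_mod_cast hx) (by norm_num)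
  have hzpos : 0 < (chenZ x : ℝ) - 1 := by linarith
  have hJ : ((x : ℝ) + h) / ((chenZ x : ℝ) - 1) ≤ 4 * P := by
    rw [div_le_iff₀ hzpos]
    have hxP : (x : ℝ) = P * (x : ℝ) ^ (1 / 10 : ℝ) := by
      rw [hP, ← Real.rpow_add hx0]; norm_num
    have h2x : (x : ℝ) + h ≤ 2 * (P * (x : ℝ) ^ (1 / 10 : ℝ)) := by rw [← hxP]; linarith
    have h3 : (x : ℝ) ^ (1 / 10 : ℝ) ≤ 2 * ((chenZ x : ℝ) - 1) := by linarith
    calc (x : ℝ) + h ≤ 2 * (P * (x : ℝ) ^ (1 / 10 : ℝ)) := h2x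
      _ ≤ 2 * (P * (2 * ((chenZ x : ℝ) - 1))) := by gcongr
      _ = 4 * P * ((chenZ x : ℝ) - 1) := by ring
  linarith

/-- For `θ < 1` and `c > 0`, eventually `K x^θ ≤ c x/(log x)²` (`(log x)² = o(x^{1−θ})`). [folklore] -/
theorem eventually_rpow_le_mul_div_log_sq {θ K c : ℝ} (hθ : θ < 1) (hc : 0 < c) :
    ∀ᶠ x : ℕ in atTop, K * (x : ℝ) ^ θ ≤ c * x / Real.log x ^ 2 := by
  rcases le_or_gt K 0 with hK | hK
  · filter_upwards [eventually_ge_atTop 2] with x hx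
    have hx1 : (1 : ℝ) < x := by exact_mod_cast (show 1 < x by omega)
    have hx0 : (0 : ℝ) < x := by linarith
    have hlog : 0 < Real.log x := Real.log_pos hx1
    have h1 : K * (x : ℝ) ^ θ ≤ 0 := mul_nonpos_of_nonpos_of_nonneg hK (Real.rpow_nonneg hx0.le _)
    have h2 : 0 ≤ c * x / Real.log x ^ 2 := by positivity
    linarith
  have hlo := (isLittleO_log_rpow_rpow_atTop 2 (show (0 : ℝ) < 1 - θ by linarith)).def
    (show 0 < c / K by positivity)
  have hlo' := tendsto_natCast_atTop_atTop.eventually hlo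
  filter_upwards [hlo', eventually_ge_atTop 2] with x hx hx2
  have hx1 : (1 : ℝ) < x := by exact_mod_cast (show 1 < x by omega)
  have hx0 : (0 : ℝ) < x := by linarith
  have hlog : 0 < Real.log x := Real.log_pos hx1
  rw [Real.norm_of_nonneg (by positivity), Real.norm_of_nonneg (Real.rpow_nonneg hx0.le _)] at hx
  rw [le_div_iff₀ (by positivity)]
  have hxsplit : (x : ℝ) = (x : ℝ) ^ θ * (x : ℝ) ^ (1 - θ) := by
    rw [← Real.rpow_add hx0]; norm_num
  have hlog2 : Real.log (x : ℝ) ^ (2 : ℝ) = Real.log x ^ 2 := by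
    rw [show (2 : ℝ) = ((2 : ℕ) : ℝ) by norm_num, Real.rpow_natCast]
  rw [hlog2] at hx
  calc K * (x : ℝ) ^ θ * Real.log x ^ 2 = (x : ℝ) ^ θ * (K * Real.log x ^ 2) := by ring
    _ ≤ (x : ℝ) ^ θ * (K * (c / K * (x : ℝ) ^ (1 - θ))) := by
        refine mul_le_mul_of_nonneg_left ?_ (Real.rpow_nonneg hx0.le _)
        exact mul_le_mul_of_nonneg_left hx hK.le
    _ = c * ((x : ℝ) ^ θ * (x : ℝ) ^ (1 - θ)) := by field_simp
    _ = c * x := by rw [← hxsplit]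

end Literature.NumberTheory.Sieve.Chen
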